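import Literature.Analysis.Calculus.LineIntegrationBootstrapJets   -- ★ p846509 (d1″): `forall_norm_iteratedFDeriv_bounded_of_uniform_loss_two_walls`
import HarnessLib

/-!
# Line-integration bootstrap on the six WEYL CHAMBERS of a rank-two torus with two singular root walls through one index (Harish-Chandra ∕ Warner II §8.4.3 for `𝔲(2,1)`)

Topic `Analysis/Calculus`; namespace `Literature.Analysis.Calculus.LineBootstrap`.  THEOREMS ONLY (no `def`, no instance, no notation, no axiom, no named fact, no `sorry`).
Cell `pub/hodgecm-mathlib`, ENGINE T1 (crux H413 = `stmt-HodgeConjecture-24833`); ROAD «A6-IV» (owner∕architect F0P3a-p05 (g15), DESIGN v2 93542b84b04a2b0a), brick **(d1‴)** = the CHAMBER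
GEOMETRY of (d2) «JET-BOUND BOOTSTRAP» over ★ (d1″) p846509; pen F0P3a-p02 (g14), 2026-09-01.

THE MATHEMATICS [WarnerHASSLG2, §8.4.3, proof of Thm. 8.4.3.1, for `G = U(2,1)`].  Coordinates `θ : Fin 3 → ℝ` on the torus; the SINGULAR («noncompact») root walls are `θ₂ = θ_a`
(`a ∈ {0,1}`), the wall `θ₀ = θ₁` is regular («compact»: the function is smooth across it).  For `{a, b} = {0, 1}` the six chambers are
(S) `θ_a < θ₂ < θ_b` — BOTH walls singular; (D⁺) `θ_a < θ_b < θ₂` and (D⁻) `θ₂ < θ_a < θ_b` — ONE singular wall (`θ₂ = θ_b`, resp. `θ₂ = θ_a`), the other singular root modulus dominating it.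
For each type and each `δ > 0` an explicit TRIMMED CHAMBER `T` with `C ∩ B(0, δ∕2) ⊆ T ⊆ C ∩ B(0, 2δ)` closed under the exit segments of ★ (d1′)∕(d1″) (exit direction = move ONE free coordinate,
normalised so that the singular root modulus is raised to the level `δ` without lowering the other), whence — from ★ `forall_norm_iteratedFDeriv_bounded_of_uniform_loss_two_walls` —
**on every chamber: `φ` smooth on an open `U ⊇ T` and `‖Dⁿφ(θ)‖ ≤ C_n·(singular root moduli)^{−n₀}` on `T` for ONE `n₀` and all `n` ⟹ `‖Dⁿφ(θ)‖ ≤ M_n` on `T`, in particular on `C ∩ B(0, δ∕2)`.**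
(d2) proper = produce the uniform `n₀` from (b3)+(e)+(c3′); (f1) = read the output at `n = 4` into ★ `ArchCentralLimitFormulaRankTwo.of_chamberJetBounds_local`.
HONEST LABEL: HC_CM is proved only modulo the printed citations until rung 0 closes; calculus on `ℝ³`, pays nothing by itself.

* [WarnerHASSLG2] G. Warner, *Harmonic Analysis on Semi-Simple Lie Groups II* (1972), §8.4.3, Thm. 8.4.3.1 (proof), §8.4.1 (the chambers of `𝔧` cut by the singular roots).
* [Rudin1976] W. Rudin, *Principles of Mathematical Analysis*, 3rd ed. (1976), Thm. 9.21.
-/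

noncomputable section

open Set Metric

open scoped ContDiff

namespace Literature.Analysis.Calculus.LineBootstrap

variable {E : Type*} [NormedAddCommGroup E] [NormedSpace ℝ E]

/-! ### §1 Coordinates along an exit segment `θ + s•(c • e_i)` -/

section Coordinates

/-- Moving the coordinate `i`: `(θ + s•(c•e_i)) i = θ i + s·c`. [cite: Rudin1976, Thm. 9.21] -/
theorem add_smul_smul_single_apply_same (θ : Fin 3 → ℝ) (i : Fin 3) (c s : ℝ) :
    (θ + s • (c • (Pi.single i (1 : ℝ) : Fin 3 → ℝ))) i = θ i + s * c := by
  simp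

/-- Moving the coordinate `i` leaves the coordinate `j ≠ i` unchanged. [cite: Rudin1976, Thm. 9.21] -/
theorem add_smul_smul_single_apply_ne (θ : Fin 3 → ℝ) {i j : Fin 3} (h : j ≠ i) (c s : ℝ) :
    (θ + s • (c • (Pi.single i (1 : ℝ) : Fin 3 → ℝ))) j = θ j := by
  simp [h]

/-- The scaled root form `(θ_i − θ_j)∕δ` as a linear map, evaluated. [cite: WarnerHASSLG2, §8.4.1] -/
theorem rootForm_apply (i j : Fin 3) (δ : ℝ) (θ : Fin 3 → ℝ) :
    (δ⁻¹ • ((LinearMap.proj i : (Fin 3 → ℝ) →ₗ[ℝ] ℝ) - (LinearMap.proj j : (Fin 3 → ℝ) →ₗ[ℝ] ℝ))) θ = δ⁻¹ * (θ i - θ j) := by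
  simp

/-- In the sup norm, `‖θ‖ < r ↔ ∀ i, |θ i| < r` (`r > 0`). [cite: Rudin1976, Thm. 9.21] -/
theorem norm_lt_iff_forall_abs_lt {r : ℝ} (hr : 0 < r) (θ : Fin 3 → ℝ) : ‖θ‖ < r ↔ ∀ i, |θ i| < r := by
  rw [pi_norm_lt_iff hr]
  simp only [Real.norm_eq_abs]

/-- Unscaling a loss: `((θ-modulus)^n)⁻¹ = (δ^n)⁻¹·((modulus∕δ)^n)⁻¹`. [cite: Rudin1976, Thm. 9.21] -/
theorem inv_pow_eq_inv_pow_mul_inv_pow_div {δ x : ℝ} (hδ : δ ≠ 0) (n : ℕ) : (x ^ n)⁻¹ = (δ ^ n)⁻¹ * ((δ⁻¹ * x) ^ n)⁻¹ := by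
  rw [mul_pow, mul_inv, inv_pow, inv_inv, ← mul_assoc, inv_mul_cancel₀ (pow_ne_zero n hδ), one_mul]

end Coordinates

/-! ### §2 Type (S): `θ_a < θ₂ < θ_b`, both walls singular -/

section TypeS

/-- **CHAMBER (S) `θ_a < θ₂ < θ_b`: BOUNDED JETS FROM A UNIFORM LOSS.**  `{a,b} = {0,1}`, `δ > 0`, trimmed chamber
`T = {θ_a < θ₂ < θ_b, θ₂ − θ_a ≤ δ, θ_b − θ₂ ≤ δ, |θ₂| < δ}`; `φ` smooth on an open `U ⊇ T`.  If `‖Dⁿφ(θ)‖ ≤ C_n·(θ₂−θ_a)^{−n₀}·(θ_b−θ₂)^{−n₀′}` on `T` for all `n` (ONE pair of exponents), then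
`‖Dⁿφ(θ)‖ ≤ M_n` on `T` for all `n`.  Exit directions: `−δ•e_a` (raises `θ₂ − θ_a` to `δ`, fixes `θ_b − θ₂`) and `+δ•e_b`. [cite: WarnerHASSLG2, §8.4.3, Thm. 8.4.3.1 (proof)] -/
theorem chamberS_forall_norm_iteratedFDeriv_bounded (a b : Fin 3) (hab : a ≠ b) (ha : a ≠ 2) (hb : b ≠ 2) {δ : ℝ} (hδ : 0 < δ) (φ : (Fin 3 → ℝ) → E)
    {U : Set (Fin 3 → ℝ)} (hU : IsOpen U) (hφ : ContDiffOn ℝ ∞ φ U)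
    (hTU : {θ : Fin 3 → ℝ | θ a < θ 2 ∧ θ 2 < θ b ∧ θ 2 - θ a ≤ δ ∧ θ b - θ 2 ≤ δ ∧ |θ 2| < δ} ⊆ U) (n₀ n₀' : ℕ)
    (h : ∀ n : ℕ, ∃ C : ℝ, 0 ≤ C ∧ ∀ θ ∈ {θ : Fin 3 → ℝ | θ a < θ 2 ∧ θ 2 < θ b ∧ θ 2 - θ a ≤ δ ∧ θ b - θ 2 ≤ δ ∧ |θ 2| < δ},
      ‖iteratedFDeriv ℝ n φ θ‖ ≤ C * ((θ 2 - θ a) ^ n₀)⁻¹ * ((θ b - θ 2) ^ n₀')⁻¹) :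
    ∀ n : ℕ, ∃ M : ℝ, 0 ≤ M ∧ ∀ θ ∈ {θ : Fin 3 → ℝ | θ a < θ 2 ∧ θ 2 < θ b ∧ θ 2 - θ a ≤ δ ∧ θ b - θ 2 ≤ δ ∧ |θ 2| < δ},
      ‖iteratedFDeriv ℝ n φ θ‖ ≤ M := by
  set T : Set (Fin 3 → ℝ) := {θ : Fin 3 → ℝ | θ a < θ 2 ∧ θ 2 < θ b ∧ θ 2 - θ a ≤ δ ∧ θ b - θ 2 ≤ δ ∧ |θ 2| < δ} with hTdef
  have h2a : (2 : Fin 3) ≠ a := fun h => ha h.symm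
  have h2b : (2 : Fin 3) ≠ b := fun h => hb h.symm
  -- the two scaled singular root forms and the exit directions
  set β : (Fin 3 → ℝ) →ₗ[ℝ] ℝ := δ⁻¹ • ((LinearMap.proj (2 : Fin 3) : (Fin 3 → ℝ) →ₗ[ℝ] ℝ) - (LinearMap.proj a : (Fin 3 → ℝ) →ₗ[ℝ] ℝ)) with hβdef
  set β' : (Fin 3 → ℝ) →ₗ[ℝ] ℝ := δ⁻¹ • ((LinearMap.proj b : (Fin 3 → ℝ) →ₗ[ℝ] ℝ) - (LinearMap.proj (2 : Fin 3) : (Fin 3 → ℝ) →ₗ[ℝ] ℝ)) with hβ'def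
  set e : Fin 3 → ℝ := (-δ) • (Pi.single a (1 : ℝ) : Fin 3 → ℝ) with hedef
  set e' : Fin 3 → ℝ := δ • (Pi.single b (1 : ℝ) : Fin 3 → ℝ) with he'def
  have hβ : ∀ θ, β θ = δ⁻¹ * (θ 2 - θ a) := fun θ => rootForm_apply 2 a δ θ
  have hβ' : ∀ θ, β' θ = δ⁻¹ * (θ b - θ 2) := fun θ => rootForm_apply b 2 δ θ
  have hδ0 : δ ≠ 0 := hδ.ne'
  have hβe : β e = 1 := by
    rw [hβ, hedef]; simp [h2a]; field_simp
  have hβ'e' : β' e' = 1 := by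
    rw [hβ', he'def]; simp [h2b]; field_simp
  have hβ'e : 0 ≤ β' e := by
    rw [hβ', hedef]; simp [h2a, hab.symm]
  have hT : ∀ θ ∈ T, 0 < β θ ∧ β θ ≤ 1 := by
    intro θ hθ; rw [hβ]
    exact ⟨mul_pos (inv_pos.2 hδ) (by linarith [hθ.1]), by rw [inv_mul_le_iff₀ hδ]; linarith [hθ.2.2.1]⟩
  have hT' : ∀ θ ∈ T, 0 < β' θ ∧ β' θ ≤ 1 := by
    intro θ hθ; rw [hβ']
    exact ⟨mul_pos (inv_pos.2 hδ) (by linarith [hθ.2.1]), by rw [inv_mul_le_iff₀ hδ]; linarith [hθ.2.2.2.1]⟩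
  -- closure under the exit segments
  have hseg : ∀ θ ∈ T, ∀ s ∈ Icc (0 : ℝ) (1 - β θ), θ + s • e ∈ T := by
    intro θ hθ s hs
    obtain ⟨h1, h2, h3, h4, h5⟩ := hθ
    have hs1 : s ≤ 1 - δ⁻¹ * (θ 2 - θ a) := by rw [← hβ]; exact hs.2
    have hsδ : s * δ ≤ δ - (θ 2 - θ a) := by
      have := mul_le_mul_of_nonneg_right hs1 hδ.le
      rwa [sub_mul, one_mul, mul_comm δ⁻¹, mul_assoc, inv_mul_cancel₀ hδ0, mul_one] at this
    have ea : (θ + s • e) a = θ a + s * (-δ) := by rw [hedef]; exact add_smul_smul_single_apply_same θ a (-δ) s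
    have e2 : (θ + s • e) 2 = θ 2 := by rw [hedef]; exact add_smul_smul_single_apply_ne θ h2a (-δ) s
    have eb : (θ + s • e) b = θ b := by rw [hedef]; exact add_smul_smul_single_apply_ne θ hab.symm (-δ) s
    refine ⟨?_, ?_, ?_, ?_, ?_⟩ <;> simp only [ea, e2, eb] <;> nlinarith [hs.1, hδ]
  have hseg' : ∀ θ ∈ T, ∀ s ∈ Icc (0 : ℝ) (1 - β' θ), θ + s • e' ∈ T := by
    intro θ hθ s hs
    obtain ⟨h1, h2, h3, h4, h5⟩ := hθ
    have hs1 : s ≤ 1 - δ⁻¹ * (θ b - θ 2) := by rw [← hβ']; exact hs.2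
    have hsδ : s * δ ≤ δ - (θ b - θ 2) := by
      have := mul_le_mul_of_nonneg_right hs1 hδ.le
      rwa [sub_mul, one_mul, mul_comm δ⁻¹, mul_assoc, inv_mul_cancel₀ hδ0, mul_one] at this
    have eb : (θ + s • e') b = θ b + s * δ := by rw [he'def]; exact add_smul_smul_single_apply_same θ b δ s
    have e2 : (θ + s • e') 2 = θ 2 := by rw [he'def]; exact add_smul_smul_single_apply_ne θ h2b δ s
    have ea : (θ + s • e') a = θ a := by rw [he'def]; exact add_smul_smul_single_apply_ne θ hab δ s
    refine ⟨?_, ?_, ?_, ?_, ?_⟩ <;> simp only [ea, e2, eb] <;> nlinarith [hs.1, hδ]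
  -- the loss in the scaled forms
  have hloss : ∀ n : ℕ, ∃ C : ℝ, 0 ≤ C ∧ ∀ θ ∈ T, ‖iteratedFDeriv ℝ n φ θ‖ ≤ C * ((β θ) ^ n₀)⁻¹ * ((β' θ) ^ n₀')⁻¹ := by
    intro n
    obtain ⟨C, hC, hCb⟩ := h n
    refine ⟨C * (δ ^ n₀)⁻¹ * (δ ^ n₀')⁻¹, by positivity, fun θ hθ => ?_⟩
    have := hCb θ hθ
    rw [inv_pow_eq_inv_pow_mul_inv_pow_div hδ0 n₀, inv_pow_eq_inv_pow_mul_inv_pow_div hδ0 n₀' (x := θ b - θ 2), ← hβ, ← hβ'] at this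
    calc ‖iteratedFDeriv ℝ n φ θ‖ ≤ C * ((δ ^ n₀)⁻¹ * (β θ ^ n₀)⁻¹) * ((δ ^ n₀')⁻¹ * (β' θ ^ n₀')⁻¹) := this
      _ = C * (δ ^ n₀)⁻¹ * (δ ^ n₀')⁻¹ * (β θ ^ n₀)⁻¹ * (β' θ ^ n₀')⁻¹ := by ring
  exact forall_norm_iteratedFDeriv_bounded_of_uniform_loss_two_walls φ hU hφ β β' e e' hβe hβ'e' hβ'e T hTU hT hT' hseg hseg' n₀ n₀' hloss

/-- The trimmed chamber (S) contains the chamber near the corner: `{θ_a < θ₂ < θ_b} ∩ B(0, δ∕2) ⊆ T`. [cite: WarnerHASSLG2, §8.4.1] -/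
theorem chamberS_inter_ball_subset (a b : Fin 3) {δ : ℝ} (hδ : 0 < δ) :
    {θ : Fin 3 → ℝ | θ a < θ 2 ∧ θ 2 < θ b} ∩ ball 0 (δ / 2) ⊆
      {θ : Fin 3 → ℝ | θ a < θ 2 ∧ θ 2 < θ b ∧ θ 2 - θ a ≤ δ ∧ θ b - θ 2 ≤ δ ∧ |θ 2| < δ} := by
  rintro θ ⟨⟨h1, h2⟩, hball⟩
  rw [mem_ball_zero_iff, norm_lt_iff_forall_abs_lt (by positivity)] at hball
  have ha := hball a; have hb := hball b; have h2' := hball 2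
  rw [abs_lt] at ha hb h2'
  exact ⟨h1, h2, by linarith, by linarith, abs_lt.2 ⟨by linarith, by linarith⟩⟩

/-- The trimmed chamber (S) is bounded: `T ⊆ B(0, 2δ)` (so an a-priori bound «on `C ∩ B(0, r₀)`» applies on `T` once `2δ ≤ r₀`). [cite: WarnerHASSLG2, §8.4.1] -/
theorem chamberS_subset_ball (a b : Fin 3) (ha : a ≠ 2) (hb : b ≠ 2) (hab : a ≠ b) {δ : ℝ} (hδ : 0 < δ) :
    {θ : Fin 3 → ℝ | θ a < θ 2 ∧ θ 2 < θ b ∧ θ 2 - θ a ≤ δ ∧ θ b - θ 2 ≤ δ ∧ |θ 2| < δ} ⊆ ball 0 (2 * δ) := by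
  rintro θ ⟨h1, h2, h3, h4, h5⟩
  rw [mem_ball_zero_iff, norm_lt_iff_forall_abs_lt (by positivity)]
  rw [abs_lt] at h5
  have key : ∀ i : Fin 3, i = a ∨ i = b ∨ i = 2 := by
    intro i; fin_cases i <;> fin_cases a <;> fin_cases b <;> simp_all
  intro i
  rcases key i with rfl | rfl | rfl
  · exact abs_lt.2 ⟨by linarith, by linarith⟩
  · exact abs_lt.2 ⟨by linarith, by linarith⟩
  · exact abs_lt.2 ⟨by linarith, by linarith⟩

end TypeS

/-! ### §3 Type (D⁺): `θ_a < θ_b < θ₂`, singular wall `θ₂ = θ_b`, the modulus `θ₂ − θ_a` dominating -/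

section TypeDplus

/-- **CHAMBER (D⁺) `θ_a < θ_b < θ₂`: BOUNDED JETS FROM A UNIFORM LOSS.**  Trimmed chamber `T = {θ_a < θ_b < θ₂, θ₂ − θ_b ≤ δ, |θ_a| < δ, |θ_b| < δ}`; exit direction `+δ•e₂`
(raises both singular moduli, fixes the regular root).  Loss in BOTH singular moduli `(θ₂−θ_b)^{−n₀}(θ₂−θ_a)^{−n₀′}` allowed: on the chamber `θ₂ − θ_a ≥ θ₂ − θ_b`, so it is a loss `(θ₂−θ_b)^{−(n₀+n₀′)}`
at the single wall. [cite: WarnerHASSLG2, §8.4.3, Thm. 8.4.3.1 (proof)] -/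
theorem chamberDplus_forall_norm_iteratedFDeriv_bounded (a b : Fin 3) (ha : a ≠ 2) (hb : b ≠ 2) {δ : ℝ} (hδ : 0 < δ) (φ : (Fin 3 → ℝ) → E)
    {U : Set (Fin 3 → ℝ)} (hU : IsOpen U) (hφ : ContDiffOn ℝ ∞ φ U)
    (hTU : {θ : Fin 3 → ℝ | θ a < θ b ∧ θ b < θ 2 ∧ θ 2 - θ b ≤ δ ∧ |θ a| < δ ∧ |θ b| < δ} ⊆ U) (n₀ n₀' : ℕ)
    (h : ∀ n : ℕ, ∃ C : ℝ, 0 ≤ C ∧ ∀ θ ∈ {θ : Fin 3 → ℝ | θ a < θ b ∧ θ b < θ 2 ∧ θ 2 - θ b ≤ δ ∧ |θ a| < δ ∧ |θ b| < δ},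
      ‖iteratedFDeriv ℝ n φ θ‖ ≤ C * ((θ 2 - θ b) ^ n₀)⁻¹ * ((θ 2 - θ a) ^ n₀')⁻¹) :
    ∀ n : ℕ, ∃ M : ℝ, 0 ≤ M ∧ ∀ θ ∈ {θ : Fin 3 → ℝ | θ a < θ b ∧ θ b < θ 2 ∧ θ 2 - θ b ≤ δ ∧ |θ a| < δ ∧ |θ b| < δ},
      ‖iteratedFDeriv ℝ n φ θ‖ ≤ M := by
  set T : Set (Fin 3 → ℝ) := {θ : Fin 3 → ℝ | θ a < θ b ∧ θ b < θ 2 ∧ θ 2 - θ b ≤ δ ∧ |θ a| < δ ∧ |θ b| < δ} with hTdef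
  have h2a : (2 : Fin 3) ≠ a := fun h => ha h.symm
  have h2b : (2 : Fin 3) ≠ b := fun h => hb h.symm
  set β : (Fin 3 → ℝ) →ₗ[ℝ] ℝ := δ⁻¹ • ((LinearMap.proj (2 : Fin 3) : (Fin 3 → ℝ) →ₗ[ℝ] ℝ) - (LinearMap.proj b : (Fin 3 → ℝ) →ₗ[ℝ] ℝ)) with hβdef
  set e : Fin 3 → ℝ := δ • (Pi.single 2 (1 : ℝ) : Fin 3 → ℝ) with hedef
  have hβ : ∀ θ, β θ = δ⁻¹ * (θ 2 - θ b) := fun θ => rootForm_apply 2 b δ θ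
  have hδ0 : δ ≠ 0 := hδ.ne'
  have hβe : β e = 1 := by
    rw [hβ, hedef]; simp [hb]; field_simp
  have hβe0 : 0 ≤ β e := by rw [hβe]; exact zero_le_one
  have hT : ∀ θ ∈ T, 0 < β θ ∧ β θ ≤ 1 := by
    intro θ hθ; rw [hβ]
    exact ⟨mul_pos (inv_pos.2 hδ) (by linarith [hθ.2.1]), by rw [inv_mul_le_iff₀ hδ]; linarith [hθ.2.2.1]⟩
  have hseg : ∀ θ ∈ T, ∀ s ∈ Icc (0 : ℝ) (1 - β θ), θ + s • e ∈ T := by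
    intro θ hθ s hs
    obtain ⟨h1, h2, h3, h4, h5⟩ := hθ
    have hs1 : s ≤ 1 - δ⁻¹ * (θ 2 - θ b) := by rw [← hβ]; exact hs.2
    have hsδ : s * δ ≤ δ - (θ 2 - θ b) := by
      have := mul_le_mul_of_nonneg_right hs1 hδ.le
      rwa [sub_mul, one_mul, mul_comm δ⁻¹, mul_assoc, inv_mul_cancel₀ hδ0, mul_one] at this
    have e2 : (θ + s • e) 2 = θ 2 + s * δ := by rw [hedef]; exact add_smul_smul_single_apply_same θ 2 δ s
    have ea : (θ + s • e) a = θ a := by rw [hedef]; exact add_smul_smul_single_apply_ne θ ha δ s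
    have eb : (θ + s • e) b = θ b := by rw [hedef]; exact add_smul_smul_single_apply_ne θ hb δ s
    refine ⟨?_, ?_, ?_, ?_, ?_⟩ <;> simp only [ea, e2, eb] <;> first | exact h4 | exact h5 | nlinarith [hs.1, hδ]
  -- the loss at the single wall, exponent `n₀ + n₀′`
  have hloss : ∀ n : ℕ, ∃ C : ℝ, 0 ≤ C ∧ ∀ θ ∈ T, ‖iteratedFDeriv ℝ n φ θ‖ ≤ C * ((β θ) ^ (n₀ + n₀'))⁻¹ * ((β θ) ^ 0)⁻¹ := by
    intro n
    obtain ⟨C, hC, hCb⟩ := h n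
    refine ⟨C * (δ ^ n₀)⁻¹ * (δ ^ n₀')⁻¹, by positivity, fun θ hθ => ?_⟩
    have hθb : 0 < θ 2 - θ b := by linarith [hθ.2.1]
    have hdom : ((θ 2 - θ a) ^ n₀')⁻¹ ≤ ((θ 2 - θ b) ^ n₀')⁻¹ :=
      inv_anti₀ (pow_pos hθb _) (pow_le_pow_left₀ hθb.le (by linarith [hθ.1]) _)
    have step : ‖iteratedFDeriv ℝ n φ θ‖ ≤ C * ((θ 2 - θ b) ^ n₀)⁻¹ * ((θ 2 - θ b) ^ n₀')⁻¹ :=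
      (hCb θ hθ).trans (mul_le_mul_of_nonneg_left hdom (mul_nonneg hC (inv_nonneg.2 (pow_nonneg hθb.le _))))
    rw [inv_pow_eq_inv_pow_mul_inv_pow_div hδ0 n₀, inv_pow_eq_inv_pow_mul_inv_pow_div hδ0 n₀' (x := θ 2 - θ b), ← hβ] at step
    calc ‖iteratedFDeriv ℝ n φ θ‖ ≤ C * ((δ ^ n₀)⁻¹ * (β θ ^ n₀)⁻¹) * ((δ ^ n₀')⁻¹ * (β θ ^ n₀')⁻¹) := step
      _ = C * (δ ^ n₀)⁻¹ * (δ ^ n₀')⁻¹ * (β θ ^ (n₀ + n₀'))⁻¹ * (β θ ^ 0)⁻¹ := by rw [pow_add, mul_inv, pow_zero, inv_one]; ring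
  exact forall_norm_iteratedFDeriv_bounded_of_uniform_loss_two_walls φ hU hφ β β e e hβe hβe hβe0 T hTU hT hT hseg hseg (n₀ + n₀') 0 hloss

/-- `{θ_a < θ_b < θ₂} ∩ B(0, δ∕2) ⊆ T` for the trimmed chamber (D⁺). [cite: WarnerHASSLG2, §8.4.1] -/
theorem chamberDplus_inter_ball_subset (a b : Fin 3) {δ : ℝ} (hδ : 0 < δ) :
    {θ : Fin 3 → ℝ | θ a < θ b ∧ θ b < θ 2} ∩ ball 0 (δ / 2) ⊆
      {θ : Fin 3 → ℝ | θ a < θ b ∧ θ b < θ 2 ∧ θ 2 - θ b ≤ δ ∧ |θ a| < δ ∧ |θ b| < δ} := by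
  rintro θ ⟨⟨h1, h2⟩, hball⟩
  rw [mem_ball_zero_iff, norm_lt_iff_forall_abs_lt (by positivity)] at hball
  have ha := hball a; have hb := hball b; have h2' := hball 2
  rw [abs_lt] at ha hb h2'
  exact ⟨h1, h2, by linarith, abs_lt.2 ⟨by linarith, by linarith⟩, abs_lt.2 ⟨by linarith, by linarith⟩⟩

/-- `T ⊆ B(0, 2δ)` for the trimmed chamber (D⁺). [cite: WarnerHASSLG2, §8.4.1] -/
theorem chamberDplus_subset_ball (a b : Fin 3) (ha : a ≠ 2) (hb : b ≠ 2) (hab : a ≠ b) {δ : ℝ} (hδ : 0 < δ) :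
    {θ : Fin 3 → ℝ | θ a < θ b ∧ θ b < θ 2 ∧ θ 2 - θ b ≤ δ ∧ |θ a| < δ ∧ |θ b| < δ} ⊆ ball 0 (2 * δ) := by
  rintro θ ⟨h1, h2, h3, h4, h5⟩
  rw [mem_ball_zero_iff, norm_lt_iff_forall_abs_lt (by positivity)]
  rw [abs_lt] at h4 h5
  have key : ∀ i : Fin 3, i = a ∨ i = b ∨ i = 2 := by
    intro i; fin_cases i <;> fin_cases a <;> fin_cases b <;> simp_all
  intro i
  rcases key i with rfl | rfl | rfl
  · exact abs_lt.2 ⟨by linarith, by linarith⟩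
  · exact abs_lt.2 ⟨by linarith, by linarith⟩
  · exact abs_lt.2 ⟨by linarith, by linarith⟩

end TypeDplus

/-! ### §4 Type (D⁻): `θ₂ < θ_a < θ_b`, singular wall `θ₂ = θ_a`, the modulus `θ_b − θ₂` dominating -/

section TypeDminus

/-- **CHAMBER (D⁻) `θ₂ < θ_a < θ_b`: BOUNDED JETS FROM A UNIFORM LOSS.**  Trimmed chamber `T = {θ₂ < θ_a < θ_b, θ_a − θ₂ ≤ δ, |θ_a| < δ, |θ_b| < δ}`; exit direction `−δ•e₂`.
Loss `(θ_a−θ₂)^{−n₀}(θ_b−θ₂)^{−n₀′}` allowed (`θ_b − θ₂ ≥ θ_a − θ₂` on the chamber). [cite: WarnerHASSLG2, §8.4.3, Thm. 8.4.3.1 (proof)] -/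
theorem chamberDminus_forall_norm_iteratedFDeriv_bounded (a b : Fin 3) (ha : a ≠ 2) (hb : b ≠ 2) {δ : ℝ} (hδ : 0 < δ) (φ : (Fin 3 → ℝ) → E)
    {U : Set (Fin 3 → ℝ)} (hU : IsOpen U) (hφ : ContDiffOn ℝ ∞ φ U)
    (hTU : {θ : Fin 3 → ℝ | θ 2 < θ a ∧ θ a < θ b ∧ θ a - θ 2 ≤ δ ∧ |θ a| < δ ∧ |θ b| < δ} ⊆ U) (n₀ n₀' : ℕ)
    (h : ∀ n : ℕ, ∃ C : ℝ, 0 ≤ C ∧ ∀ θ ∈ {θ : Fin 3 → ℝ | θ 2 < θ a ∧ θ a < θ b ∧ θ a - θ 2 ≤ δ ∧ |θ a| < δ ∧ |θ b| < δ},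
      ‖iteratedFDeriv ℝ n φ θ‖ ≤ C * ((θ a - θ 2) ^ n₀)⁻¹ * ((θ b - θ 2) ^ n₀')⁻¹) :
    ∀ n : ℕ, ∃ M : ℝ, 0 ≤ M ∧ ∀ θ ∈ {θ : Fin 3 → ℝ | θ 2 < θ a ∧ θ a < θ b ∧ θ a - θ 2 ≤ δ ∧ |θ a| < δ ∧ |θ b| < δ},
      ‖iteratedFDeriv ℝ n φ θ‖ ≤ M := by
  set T : Set (Fin 3 → ℝ) := {θ : Fin 3 → ℝ | θ 2 < θ a ∧ θ a < θ b ∧ θ a - θ 2 ≤ δ ∧ |θ a| < δ ∧ |θ b| < δ} with hTdef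
  set β : (Fin 3 → ℝ) →ₗ[ℝ] ℝ := δ⁻¹ • ((LinearMap.proj a : (Fin 3 → ℝ) →ₗ[ℝ] ℝ) - (LinearMap.proj (2 : Fin 3) : (Fin 3 → ℝ) →ₗ[ℝ] ℝ)) with hβdef
  set e : Fin 3 → ℝ := (-δ) • (Pi.single 2 (1 : ℝ) : Fin 3 → ℝ) with hedef
  have hβ : ∀ θ, β θ = δ⁻¹ * (θ a - θ 2) := fun θ => rootForm_apply a 2 δ θ
  have hδ0 : δ ≠ 0 := hδ.ne'
  have hβe : β e = 1 := by
    rw [hβ, hedef]; simp [ha]; field_simp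
  have hβe0 : 0 ≤ β e := by rw [hβe]; exact zero_le_one
  have hT : ∀ θ ∈ T, 0 < β θ ∧ β θ ≤ 1 := by
    intro θ hθ; rw [hβ]
    exact ⟨mul_pos (inv_pos.2 hδ) (by linarith [hθ.1]), by rw [inv_mul_le_iff₀ hδ]; linarith [hθ.2.2.1]⟩
  have hseg : ∀ θ ∈ T, ∀ s ∈ Icc (0 : ℝ) (1 - β θ), θ + s • e ∈ T := by
    intro θ hθ s hs
    obtain ⟨h1, h2, h3, h4, h5⟩ := hθ
    have hs1 : s ≤ 1 - δ⁻¹ * (θ a - θ 2) := by rw [← hβ]; exact hs.2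
    have hsδ : s * δ ≤ δ - (θ a - θ 2) := by
      have := mul_le_mul_of_nonneg_right hs1 hδ.le
      rwa [sub_mul, one_mul, mul_comm δ⁻¹, mul_assoc, inv_mul_cancel₀ hδ0, mul_one] at this
    have e2 : (θ + s • e) 2 = θ 2 + s * (-δ) := by rw [hedef]; exact add_smul_smul_single_apply_same θ 2 (-δ) s
    have ea : (θ + s • e) a = θ a := by rw [hedef]; exact add_smul_smul_single_apply_ne θ ha (-δ) s
    have eb : (θ + s • e) b = θ b := by rw [hedef]; exact add_smul_smul_single_apply_ne θ hb (-δ) s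
    refine ⟨?_, ?_, ?_, ?_, ?_⟩ <;> simp only [ea, e2, eb] <;> first | exact h2 | exact h4 | exact h5 | nlinarith [hs.1, hδ]
  have hloss : ∀ n : ℕ, ∃ C : ℝ, 0 ≤ C ∧ ∀ θ ∈ T, ‖iteratedFDeriv ℝ n φ θ‖ ≤ C * ((β θ) ^ (n₀ + n₀'))⁻¹ * ((β θ) ^ 0)⁻¹ := by
    intro n
    obtain ⟨C, hC, hCb⟩ := h n
    refine ⟨C * (δ ^ n₀)⁻¹ * (δ ^ n₀')⁻¹, by positivity, fun θ hθ => ?_⟩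
    have hθa : 0 < θ a - θ 2 := by linarith [hθ.1]
    have hdom : ((θ b - θ 2) ^ n₀')⁻¹ ≤ ((θ a - θ 2) ^ n₀')⁻¹ :=
      inv_anti₀ (pow_pos hθa _) (pow_le_pow_left₀ hθa.le (by linarith [hθ.2.1]) _)
    have step : ‖iteratedFDeriv ℝ n φ θ‖ ≤ C * ((θ a - θ 2) ^ n₀)⁻¹ * ((θ a - θ 2) ^ n₀')⁻¹ :=
      (hCb θ hθ).trans (mul_le_mul_of_nonneg_left hdom (mul_nonneg hC (inv_nonneg.2 (pow_nonneg hθa.le _))))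
    rw [inv_pow_eq_inv_pow_mul_inv_pow_div hδ0 n₀, inv_pow_eq_inv_pow_mul_inv_pow_div hδ0 n₀' (x := θ a - θ 2), ← hβ] at step
    calc ‖iteratedFDeriv ℝ n φ θ‖ ≤ C * ((δ ^ n₀)⁻¹ * (β θ ^ n₀)⁻¹) * ((δ ^ n₀')⁻¹ * (β θ ^ n₀')⁻¹) := step
      _ = C * (δ ^ n₀)⁻¹ * (δ ^ n₀')⁻¹ * (β θ ^ (n₀ + n₀'))⁻¹ * (β θ ^ 0)⁻¹ := by rw [pow_add, mul_inv, pow_zero, inv_one]; ring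
  exact forall_norm_iteratedFDeriv_bounded_of_uniform_loss_two_walls φ hU hφ β β e e hβe hβe hβe0 T hTU hT hT hseg hseg (n₀ + n₀') 0 hloss

/-- `{θ₂ < θ_a < θ_b} ∩ B(0, δ∕2) ⊆ T` for the trimmed chamber (D⁻). [cite: WarnerHASSLG2, §8.4.1] -/
theorem chamberDminus_inter_ball_subset (a b : Fin 3) {δ : ℝ} (hδ : 0 < δ) :
    {θ : Fin 3 → ℝ | θ 2 < θ a ∧ θ a < θ b} ∩ ball 0 (δ / 2) ⊆
      {θ : Fin 3 → ℝ | θ 2 < θ a ∧ θ a < θ b ∧ θ a - θ 2 ≤ δ ∧ |θ a| < δ ∧ |θ b| < δ} := by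
  rintro θ ⟨⟨h1, h2⟩, hball⟩
  rw [mem_ball_zero_iff, norm_lt_iff_forall_abs_lt (by positivity)] at hball
  have ha := hball a; have hb := hball b; have h2' := hball 2
  rw [abs_lt] at ha hb h2'
  exact ⟨h1, h2, by linarith, abs_lt.2 ⟨by linarith, by linarith⟩, abs_lt.2 ⟨by linarith, by linarith⟩⟩

/-- `T ⊆ B(0, 2δ)` for the trimmed chamber (D⁻). [cite: WarnerHASSLG2, §8.4.1] -/
theorem chamberDminus_subset_ball (a b : Fin 3) (ha : a ≠ 2) (hb : b ≠ 2) (hab : a ≠ b) {δ : ℝ} (hδ : 0 < δ) :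
    {θ : Fin 3 → ℝ | θ 2 < θ a ∧ θ a < θ b ∧ θ a - θ 2 ≤ δ ∧ |θ a| < δ ∧ |θ b| < δ} ⊆ ball 0 (2 * δ) := by
  rintro θ ⟨h1, h2, h3, h4, h5⟩
  rw [mem_ball_zero_iff, norm_lt_iff_forall_abs_lt (by positivity)]
  rw [abs_lt] at h4 h5
  have key : ∀ i : Fin 3, i = a ∨ i = b ∨ i = 2 := by
    intro i; fin_cases i <;> fin_cases a <;> fin_cases b <;> simp_all
  intro i
  rcases key i with rfl | rfl | rfl
  · exact abs_lt.2 ⟨by linarith, by linarith⟩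
  · exact abs_lt.2 ⟨by linarith, by linarith⟩
  · exact abs_lt.2 ⟨by linarith, by linarith⟩

end TypeDminus

end Literature.Analysis.Calculus.LineBootstrap

end
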